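import Summits.HodgeConjecture.Statement
import Summits.HodgeConjecture.HodgeConjecture.Theses.RankFourFaces
import Summits.HodgeConjecture.HodgeConjecture.Theses.PadicSemiregularLift
import Summits.HodgeConjecture.HodgeConjecture.Theorems.WeilTypeLadder
import Summits.HodgeConjecture.HodgeConjecture.Theorems.WeilTypeLadderOnPath
import Summits.HodgeConjecture.HodgeConjecture.Theorems.PadicSemiregularLiftHodgeAbelianVarietiesUnconditionalCorners
import Literature.AlgebraicGeometry.HodgeTheory.WeilTypeAbelianVariety
import Literature.AlgebraicGeometry.HodgeTheory.WeilTypeHodgeRing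
import Literature.AlgebraicGeometry.HodgeTheory.WeilClassesSixfolds
import Literature.AlgebraicGeometry.HodgeTheory.LefschetzOneOneHolds
import Literature.AlgebraicGeometry.Motives.HyperbolicWeilTypeProduct
import HarnessLib

/-!
# Ring 2 · statement layer (typer1) — HC for Weil-type abelian varieties with divisor–Weil-generated Hodge ring, from the Weil classes

HONEST FRAMING: research route conditional on HC_CM; not a corollary; Q11.4-sentence-2 already refuted in dim ≥ 3.

Cell `pub-hodge-ring2`, seat `pub-hodge-ring2-typer1`. Companion of `Theorems/Ring2WeilTypeTargets.lean` (row WΔ of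
`RING2-MAP.md` §typer1; closes §transport row T6 "owed"). `HC_CM` = `Theses.RankFourFaces.CMAbelianHodge` is a BINDER
wherever it occurs; no internally-minted statement is cited; sorry-free; no new `def` (class targets are local
notations, bodies verbatim the staged `Summits/HodgeConjecture/Ring2/Defs.lean`).

THE POINT (van Geemen LNM 1594 Thm. 6.12 after Weil 1977; Thm. 4.11, 6.12, 4.15). "HC for an abelian variety `A` of Weil type"
splits as [the rational `(n,n)` classes of the Weil plane `W_K` are algebraic] + [the Hodge ring of `A` is generated
by divisor classes and `W_K`]. The second summand is the Literature predicate `IsDivisorWeilGenerated A φ n d`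
(`Literature/AlgebraicGeometry/HodgeTheory/WeilTypeHodgeRing.lean`) — a THEOREM in print for the general member of
each `n²`-dimensional family (6.12: special Mumford–Tate group `SU_H`; untyped: no Mumford–Tate groups in the tree)
and FALSE for special members. Kernel content:

* `hc_weilTypeDW_of_weilClassesImaginaryQuadratic` : ladder R∞ (`WeilTypeLadder.WeilClassesImaginaryQuadratic`) ⇒
  `HC_WeilTypeDW[]` := HC for every Weil-type `(A, φ, n, d)` with `IsDivisorWeilGenerated A φ n d` — the divisor
  ring is algebraic UNCONDITIONALLY (tree theorem `HodgeAbelianVarieties.Unconditional.divisorClassesSpan_le_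
  algebraicClasses_holds`, Lefschetz (1,1)), `n = 1` is the unconditional surface case, `n ≥ 2` is R∞'s slice.
  With `Ring2WeilTypeTargets.weilClassesImaginaryQuadratic_of_hc_weilType` this places `HC_WeilTypeDW[]` BETWEEN
  R∞ and `HC_WeilType[]`:  `HC_WeilType[] ⇒ R∞ ⇒ HC_WeilTypeDW[]`.
* `hc_splitWeilSixfoldsDW_of_markman` : Markman's split-sixfold theorem ([M] arXiv:2502.03415 Thm. 1.5.1, UNREFEREED; surveyed as [S] arXiv:2509.23403 Thm. 1.2; Literature
  named fact `Markman2025_weilClasses_algebraic_hyperbolicSixfold`, untyped proof) ⇒ HC for every SPLIT Weil-type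
  sixfold with divisor–Weil-generated Hodge ring — the kernel form of "the Hodge conjecture for the generic abelian
  sixfold of Weil type with discriminant −1" (Markman, JEMS abstract), `HC_CM` playing NO role.
* `hc_weilTypeDW_of_cmToAbelian_of_hc_cm` : the `HC_CM`-routed reading (`CMToAbelian → HC_CM → HC_WeilTypeDW[]`) —
  recorded only to show it is WEAKER than what R∞ alone gives on this class.
* on-path lemmas `…_of_hodgeConjecture`.

References: [vanGeemen1994HodgeAV] 1.1, 2.4, Def. 4.9, Lemma 5.2, Thm. 4.11, Thm. 4.15, 6.11–6.12 (LNM 1594 PDF pp. 214, 218–220, 232;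
7.3 = Schoen sixfolds, NOT used); [Weil1977HodgeRing]; [Markman2025SecantWeil] Thm. 1.5.1, Cor. 1.6.1 (arXiv:2502.03415, UNREFEREED); [Markman2025SurveySecant] Thm. 1.1–1.2 (UNREFEREED
survey arXiv:2509.23403); [Markman2023GeneralizedKummers] Thm. 1.3 (JEMS 25 (2023), REFEREED: fourfolds, discriminant 1 only); [MoonenZarhin1999LowDim] Thm. 0.1; [Deligne2000] §1.
-/

set_option linter.dupNamespace false

noncomputable section

namespace Summit.HodgeConjecture.HodgeConjecture.Ring2.WeilType

open CategoryTheory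
open Literature.AlgebraicGeometry Literature.AlgebraicGeometry.Motives
open Literature.AlgebraicGeometry.HodgeTheory
open Literature.AlgebraicTopology.SingularHomology
open Summit.HodgeConjecture.HodgeConjecture.WeilTypeLadder
open Summit.HodgeConjecture.HodgeConjecture.Theses.RankFourFaces (CMAbelianHodge CMToAbelian)
open Summit.HodgeConjecture.HodgeConjecture.Theses.PadicSemiregularLift (HodgeAbelianVarieties)
open Summit.HodgeConjecture.HodgeConjecture.Theorems.HodgeAbelianVarieties.Unconditional
  (divisorClassesSpan_le_algebraicClasses_holds)

/-- `HC_WeilTypeDW[]` — the Hodge conjecture for every Weil-type pair `(A, φ)` (signature `(n,n)`, `K = ℚ(√-d)`)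
whose Hodge classes are generated by divisors and the Weil plane (`IsDivisorWeilGenerated`; van Geemen 6.12: the
general member). Local notation; body = staged `Ring2.HC_WeilTypeDW`. -/
local notation3 (prettyPrint := false) "HC_WeilTypeDW[]" =>
  ∀ (A : AbelianVariety ℂ) (φ : A ⟶ A) (n d : ℕ), IsWeilType A φ n d → IsDivisorWeilGenerated A φ n d →
    HodgeConjectureFor A.dim A.X

/-- `HC_WeilType[]` — the Hodge conjecture for every abelian variety of Weil type (as in
`Ring2WeilTypeTargets.lean`). -/
local notation3 (prettyPrint := false) "HC_WeilType[]" =>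
  ∀ (A : AbelianVariety ℂ), WeilType A → HodgeConjectureFor A.dim A.X

/-- **R∞ ⇒ HC for Weil-type abelian varieties with divisor–Weil-generated Hodge ring.** Granted the ladder's
imaginary-quadratic rung (`WeilClassesImaginaryQuadratic`: rational `(n,n)` Weil classes algebraic for all `n ≥ 2`,
all `d`), the Hodge conjecture holds for every Weil-type `(A, φ, n, d)` with `IsDivisorWeilGenerated A φ n d`: the
divisor part is algebraic unconditionally (Lefschetz (1,1) + cup products of divisor classes, tree theorem), the
Weil part by R∞ (`n ≥ 2`) — and `n = 1` (Weil surfaces) is the unconditional `dim ≤ 3` case. NO `HC_CM`.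
[cite: vanGeemen1994HodgeAV, Thm. 6.12 and 2.4 and 4.11] [cite: Weil1977HodgeRing] -/
theorem hc_weilTypeDW_of_weilClassesImaginaryQuadratic (hR : WeilClassesImaginaryQuadratic) : HC_WeilTypeDW[] := by
  intro A φ n d hW hDW
  by_cases hn : 2 ≤ n
  · exact hodgeConjectureFor_of_isDivisorWeilGenerated_of_weilClasses hW hDW
      (divisorClassesSpan_le_algebraicClasses_holds A)
      (fun A' φ' hA' hφ' c hc hH hcW ↦
        hR n hn d hW.d_pos A' φ' hA' (isSmoothProjective_of_dim_eq' hA') hφ' c hc hH hcW)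
  · have h1 : A.dim ≤ 3 := by have := hW.dim_eq; have := hW.pos; omega
    exact hodgeConjectureFor_of_dim_le_three_holds h1 (AbelianVariety.isSmoothProjective_holds (A := A))

/-- **The fixed-`(n, d)` slice**: the `(n, d)`-slice of R∞ (`n ≥ 2`) already gives HC for every Weil-type
`(A, φ, n, d)` with divisor–Weil-generated Hodge ring. [cite: vanGeemen1994HodgeAV, Thm. 6.12 and 4.11] -/
theorem hodgeConjectureFor_of_isDivisorWeilGenerated_of_slice {A : AbelianVariety ℂ} {φ : A ⟶ A} {n d : ℕ}
    (hW : IsWeilType A φ n d) (hDW : IsDivisorWeilGenerated A φ n d)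
    (hR : ∀ (A' : AbelianVariety ℂ) (φ' : A' ⟶ A'), A'.dim = 2 * n → φ' ≫ φ' = -(d • 𝟙 A') →
      ∀ c : complexBetti A'.X (2 * n), IsRationalClass c → IsOfHodgeType (2 * n) A'.X (2 * n) n n c →
        c ∈ weilClassesOf A' φ' n d → c ∈ algebraicClasses A'.X n) :
    HodgeConjectureFor A.dim A.X :=
  hodgeConjectureFor_of_isDivisorWeilGenerated_of_weilClasses hW hDW (divisorClassesSpan_le_algebraicClasses_holds A)
    hR

/-- **HC for the general SPLIT Weil sixfold, from Markman's theorem** ([M] arXiv:2502.03415 Thm. 1.5.1, UNREFEREED, surveyed as [S] Thm. 1.2; as the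
Literature named fact `Markman2025_weilClasses_algebraic_hyperbolicSixfold`: rational `(3,3)` Weil classes on
abelian sixfolds of split (hyperbolic) Weil type are algebraic, every `K = ℚ(√-d)`): every split Weil-type
`(A, φ, 3, d)` whose Hodge ring is divisor–Weil generated satisfies the Hodge conjecture — the kernel form of "the
Hodge conjecture for the generic abelian sixfold of Weil type with discriminant −1". `HC_CM` plays no role; the
general-member hypothesis is carried as `IsDivisorWeilGenerated` (6.12, untyped). [cite: Markman2025SecantWeil, Thm. 1.5.1] [cite: Markman2025SurveySecant, Thm. 1.2]
[cite: vanGeemen1994HodgeAV, Thm. 6.12 and 4.11] -/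
theorem hc_splitWeilSixfoldsDW_of_markman (hM : Markman2025_weilClasses_algebraic_hyperbolicSixfold)
    (d : ℕ) (A : AbelianVariety ℂ) (φ : A ⟶ A) (hS : IsSplitWeilType A φ 3 d)
    (hDW : IsDivisorWeilGenerated A φ 3 d) : HodgeConjectureFor A.dim A.X := by
  obtain ⟨hW, e, a, ha, ha0, hhyp⟩ := hS
  refine hodgeConjectureFor_of_isDivisorWeilGenerated hW hDW (divisorClassesSpan_le_algebraicClasses_holds A) ?_
  intro c hcW hc hH
  exact hM d hW.d_pos A φ hW.dim_eq hW.isSmoothProjective hW.sq_eq e a ha ha0 hhyp c hc hH hcW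

/-- ARROW: `HC_WeilType[] → HC_WeilTypeDW[]` (trivially: drop the Hodge-ring hypothesis).
[cite: vanGeemen1994HodgeAV, Thm. 4.11] -/
theorem hc_weilTypeDW_of_hc_weilType (h : HC_WeilType[]) : HC_WeilTypeDW[] :=
  fun A φ n d hW _ ↦ h A ⟨n, d, φ, hW⟩

/-- ARROW: `HC_AV → HC_WeilTypeDW[]`. [cite: Deligne2000, §1] -/
theorem hc_weilTypeDW_of_hc_av (h : HodgeAbelianVarieties) : HC_WeilTypeDW[] :=
  fun A _ _ _ _ _ ↦ h A

/-- ON-PATH: `HodgeConjecture → HC_WeilTypeDW[]`. [cite: Deligne2000, §1] -/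
theorem hc_weilTypeDW_of_hodgeConjecture (h : _root_.HodgeConjecture) : HC_WeilTypeDW[] :=
  hc_weilTypeDW_of_hc_av fun A ↦ h (AbelianVariety.isSmoothProjective_holds (A := A))

/-- The `HC_CM`-ROUTED reading: `CMToAbelian → HC_CM → HC_WeilTypeDW[]` — weaker than
`hc_weilTypeDW_of_weilClassesImaginaryQuadratic`, which needs neither `HC_CM` nor the route crux, only R∞
(itself reachable `HC_CM`-free in print on every quadratic-`K` Weil family: RING2-MAP §transport (iv)).
Recorded for the map, not as progress. [cite: Deligne1982HodgeCycles, Prop. 6.1] -/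
theorem hc_weilTypeDW_of_cmToAbelian_of_hc_cm (h : CMToAbelian) (hCM : CMAbelianHodge) : HC_WeilTypeDW[] :=
  fun A _ _ _ _ _ ↦ h hCM A (AbelianVariety.isSmoothProjective_holds (A := A))

/-- ON-PATH for the inputs: the Hodge conjecture implies R∞ (tree) and Markman's fact (tree
`WeilClassesSixfolds`), so nothing here exceeds the summit. [cite: Deligne2000, §1] -/
theorem inputs_of_hodgeConjecture (h : _root_.HodgeConjecture) :
    WeilClassesImaginaryQuadratic ∧ HC_WeilTypeDW[] :=
  ⟨weilClassesImaginaryQuadratic_of_hodgeConjecture h, hc_weilTypeDW_of_hodgeConjecture h⟩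

end Summit.HodgeConjecture.HodgeConjecture.Ring2.WeilType
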